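import Summits.QuantumFields.BalabanUV.T4Continuum.Spine.NE2.ComposedRemainderCoherentTower
import Summits.QuantumFields.BalabanUV.T4Continuum.Spine.NE2.DeltaPrimeData

/-!
# T⁴ programme, spine node NE2 (U1a) — r1 + r2 IN ONE END: coherent averaged towers with print's composed averaging, (124)'s remainders AND [B9] (3.10)'s `Δ′` in the last slot
# (cell `pub-balaban-gaps`, seat ne2 gen 7; after `ComposedRemainderCoherentTower` (r2, this gen) and `DeltaPrimeData` (r1, gen 3))

`ComposedRemainderCoherentTower.composed_full_averaging_rate_of_coherentTowers` still carries a free operator tower `P₄` with `PerturbationLaws` (`hP₄`) — the slot of the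
remaining summand of [B9] (3.26), the curvature term `Δ′(U_k)` of (3.10).  Gen 2–3 typed `Δ′` as an operator on the route's carriers and proved its `PerturbationLaws` from letters on the
fundamental field (`DeltaPrimeSecondOrder.perturbationLaws_deltaPrime'` fed by `DeltaPrimeData.boundedBackgroundM_zS/zF/zB_of_small`).  THIS FILE puts the two together:
 * **`topU u hu`** — the finest fields `u k k` of the towers as `U(n)`-valued bond configurations in `Δ′`'s convention (`V k ν x`);
 * **`composed_full_averaging_deltaPrime_rate_of_coherentTowers`** — the (3.26)-shape END for COHERENT averaged towers of unitary gauge fields with `P₄ := Δ′(u_k^{(k)})`: NO free operator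
   datum is displayed any more.  Binders: coherence/junk, the top plaquette letter `p_U` (+ two numerical thresholds), sizes `α_U`, top-level Lipschitz `β_U`, chain closeness `σ_U, θ_c`,
   the six plaquette-FIELD letters of `Δ′` (sizes `b_S, b_B`, block-parent consistency `σ_S, σ_B`, lattice-Lipschitz `σ_S′, σ_B′` of `S = symF(c_k²(Re U(∂p) − 1))`, `B = brkF(c_k² Im U(∂p))` —
   [B9] (3.35)–(3.36)/NE3 shapes, exactly as in `DeltaPrimeData.principalB9_deltaPrime_rate_of_small`), `Y_x ∈ P`, the frame, NE3 BY NAME, `ρ`, ONE closed-form smallness inequality.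
REMAINS (located, unchanged): every displayed letter is (3.35)/(3.36)-gauge information about Bałaban's minimiser and its averages = NE3's currency (G2); (W2″); (R7).
HONEST FRAMING (T4-DAG p. 1).  A COMPOSITION of kernel theorems about MODEL objects; `u` and the frame are DATA asserted by nobody (NOT Bałaban's minimiser); NE3 OPEN by name; the averaging is
the route's typed reading of [B7] (124)/[B9] (3.15), `Δ′` the route's typed reading of [B9] (3.10); NOT NE2, NOT [B9] (3.26) as printed; **NE2 (U1a) NOT PROVED**; spine PROVED 0/9 unchanged;
NOT continuum YM / infinite volume / mass gap / Clay.  HONEST DEPENDENCY: continuum YM on T⁴ ⇐ BetaPertH ∧ nine spine estimates (0/9 proved).  No `sorry`.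
-/

noncomputable section

open scoped BigOperators ComplexConjugate Matrix Matrix.Norms.L2Operator Kronecker
open Finset (range)

namespace Summit.QuantumFields.BalabanUV.T4Continuum.NE2.ComposedRemainderCoherentTowerDeltaPrime

open Literature.MathematicalPhysics.QuantumFieldTheory.Balaban1983to89.B5Prop11Plancherel (Tor fine unitVec Cst Cst_nonneg)
open Literature.MathematicalPhysics.QuantumFieldTheory.Balaban1983to89.B5G183RateUnitTower (lev lev_neZero)
open Literature.MathematicalPhysics.QuantumFieldTheory.Balaban1983to89.T4EtaRateMin (LocalRate)
open Summit.QuantumFields.BalabanUV.Beta.AdjointCarrierWiringEnd (CompFamily)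
open Summit.QuantumFields.BalabanUV.T4Continuum
open Summit.QuantumFields.BalabanUV.T4Continuum.BalabanAveragedTowerUnit (idx Qlev)
open Summit.QuantumFields.BalabanUV.T4Continuum.BalabanAveragedTowerModes (par)
open Summit.QuantumFields.BalabanUV.T4Continuum.BlockPairingGeometry (tau)
open Summit.QuantumFields.BalabanUV.T4Continuum.KingPairingPlantedLaw (JpcT calDalev CJ)
open Summit.QuantumFields.BalabanUV.T4Continuum.GramPerturbationLaw (C2gram)
open Summit.QuantumFields.BalabanUV.T4Continuum.CovariantAveragingTower (TowerLimitRate)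
open Summit.QuantumFields.BalabanUV.T4Continuum.BackgroundResolventTower (PerturbationLaws Cpert)
open Summit.QuantumFields.BalabanUV.T4Continuum.PerturbationAlgebra (perturbationLaws_mono)
open Summit.QuantumFields.BalabanUV.T4Continuum.RegularBackgroundTower (RegularTransporters regClass)
open Summit.QuantumFields.BalabanUV.T4Continuum.NE2FromNE3 (bgReadings)
open Summit.QuantumFields.BalabanUV.T4Continuum.CovariantAveragingSummand (kappaQ)
open Summit.QuantumFields.BalabanUV.T4Continuum.NE2BalabanLayer (tierBPert kappaB C2B)
open Summit.QuantumFields.BalabanUV.T4Continuum.NE2.CovariantTableBalaban (TBal)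
open Summit.QuantumFields.BalabanUV.T4Continuum.NE2.ComposedAveragingMean (thetaZero)
open Summit.QuantumFields.BalabanUV.T4Continuum.NE2.ComposedAveragingRemainder (avgPertFull)
open Summit.QuantumFields.BalabanUV.T4Continuum.NE2.ComposedRemainderTower (Erem cR)
open Summit.QuantumFields.BalabanUV.T4Continuum.NE2.OneStepRemainderLoopCoeff (YxT remCoeffOf)
open Summit.QuantumFields.BalabanUV.T4Continuum.NE2.ComposedRemainderGaugeTower (fundT adT)
open Summit.QuantumFields.BalabanUV.T4Continuum.NE2.ComposedRemainderRateLetters (GamU EU CrU)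
open Summit.QuantumFields.BalabanUV.T4Continuum.NE2.ComposedRemainderGaugeTowerRegular (topAdT)
open Summit.QuantumFields.BalabanUV.T4Continuum.NE2.TorusBlockAveragePlaquette (bavgTor tplaq)
open Summit.QuantumFields.BalabanUV.T4Continuum.NE2.TorusAveragedTowerPlaquette (C0')
open Summit.QuantumFields.BalabanUV.T4Continuum.NE2.ComposedRemainderCoherentTower (liftU composed_full_averaging_rate_of_coherentTowers)
open Summit.QuantumFields.BalabanUV.T4Continuum.NE2.DeltaPrimeOperator (deltaPrime)
open Summit.QuantumFields.BalabanUV.T4Continuum.NE2.DeltaPrimeCatalogue (Bfield)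
open Summit.QuantumFields.BalabanUV.T4Continuum.NE2.DeltaPrimeSecondOrder (Sfield perturbationLaws_deltaPrime' kappaDP CDP)
open Summit.QuantumFields.BalabanUV.T4Continuum.NE2.DeltaPrimeData (boundedBackgroundM_zS_of_small boundedBackgroundM_zF_of_small boundedBackgroundM_zB_of_small)

variable {d : ℕ} (L : ℕ) [NeZero L] (M : Fin d → ℕ) [hM : ∀ μ, NeZero (M μ)]
  {n : Type} [Fintype n] [DecidableEq n] {ι : Type} [Fintype ι] [DecidableEq ι] {c : ℝ} {P : Submodule ℝ (Matrix n n ℂ)} {e : ι → Matrix n n ℂ}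
  (hF : CompFamily c P e) (a : ℝ) (ha : 0 < a) [Nonempty n] [Nonempty ι]

/-! ## §1 The finest fields in `Δ′`'s convention -/

/-- the FINEST field of each tower as a `U(n)`-valued bond configuration `V k ν x` (the argument order of the `Δ′` files). [folklore] -/
def topU (u : ℕ → (i : ℕ) → Tor (fine (lev L i) M) → Fin d → (Matrix n n ℂ)ˣ) (hu : ∀ k i y κ, ((u k i y κ : (Matrix n n ℂ)ˣ) : Matrix n n ℂ) ∈ Matrix.unitaryGroup n ℂ) :
    (k : ℕ) → Fin d → Tor (fine (lev L k) M) → Matrix.unitaryGroup n ℂ := fun k ν x => ⟨(u k k x ν : Matrix n n ℂ), hu k k x ν⟩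

omit [NeZero L] hM [Nonempty n] in
/-- entries of `topU`. [folklore] -/
theorem topU_val (u : ℕ → (i : ℕ) → Tor (fine (lev L i) M) → Fin d → (Matrix n n ℂ)ˣ) (hu : ∀ k i y κ, ((u k i y κ : (Matrix n n ℂ)ˣ) : Matrix n n ℂ) ∈ Matrix.unitaryGroup n ℂ)
    (k : ℕ) (ν : Fin d) (x : Tor (fine (lev L k) M)) : ((topU L M u hu k ν x : Matrix.unitaryGroup n ℂ) : Matrix n n ℂ) = (u k k x ν : Matrix n n ℂ) := rfl

/-! ## §2 The END with `Δ′` in the last slot -/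

/-- **THE (3.26)-SHAPE END FOR COHERENT AVERAGED TOWERS WITH PRINT's COMPOSED AVERAGING, (124)'s REMAINDERS AND (3.10)'s `Δ′`** — `composed_full_averaging_rate_of_coherentTowers` with
`P₄ := Δ′(u_k^{(k)})`, its `PerturbationLaws` PROVED from the six plaquette-field letters and the size letter (`perturbationLaws_deltaPrime'` ∘ `boundedBackgroundM_zS/zF/zB_of_small`), rate
`L^{−k} ≤ ρ^k`.  No free operator datum is displayed.
[cite: Balaban1985BackgroundPropagators, (3.10) p.392, (3.15)–(3.16) p.393, (3.26) p.395, (3.35)–(3.36) pp.396–397; Balaban1985Averaging, (15) p.19, (42) p.23, Prop. 1 (51) p.26, (124) p.36, (143) p.39; King1986, Lemma 4.5 (4.38) p.674 (method)] [folklore] -/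
theorem composed_full_averaging_deltaPrime_rate_of_coherentTowers (hL : 2 ≤ L) (hd : 1 ≤ d)
    {u : ℕ → (i : ℕ) → Tor (fine (lev L i) M) → Fin d → (Matrix n n ℂ)ˣ} (hu : ∀ k i y κ, ((u k i y κ : (Matrix n n ℂ)ˣ) : Matrix n n ℂ) ∈ Matrix.unitaryGroup n ℂ)
    (hcoh : ∀ k i, i < k → u k i = bavgTor (lev L i) L M (u k (i + 1))) (hjunk : ∀ k i, k < i → u k i = fun _ _ => 1)
    {αU βU σU θc ρ pU : ℝ} (hαU : 0 ≤ αU) (hβU : 0 ≤ βU) (hσU : 0 ≤ σU) (hθ0 : 0 ≤ θc) (hθ1 : θc ≤ 1) (hθρ : θc ≤ ρ) (hρ : 3 / (2 * (L : ℝ)) ≤ ρ) (hρ1 : ρ < 1)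
    (hpU : 0 ≤ pU) (hth : 8 * C0' d * pU ≤ 1) (hpUs : d * (2 * pU) ≤ 1 / 16)
    (htop : ∀ k (y : Tor (fine (lev L k) M)) (μ ν : Fin d), μ ≠ ν → ‖((tplaq (u k k) y μ ν : (Matrix n n ℂ)ˣ) : Matrix n n ℂ) - 1‖ ≤ pU * (((L : ℝ)⁻¹) ^ 2) ^ k)
    (hUa : ∀ k i ν b, ‖(liftU L M u hu k i ν b : Matrix n n ℂ) - 1‖ ≤ αU / (lev L i : ℕ))
    (hUb : ∀ k ν μ (b : idx L M k), ‖(liftU L M u hu k k ν (tau (fine (lev L k) M) μ b) : Matrix n n ℂ) - (liftU L M u hu k k ν b : Matrix n n ℂ)‖ ≤ βU / ((lev L k : ℕ) : ℝ) ^ 2)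
    (hUc : ∀ k i ν b, i ≤ k → ‖(liftU L M u hu (k + 1) i ν b : Matrix n n ℂ) - (liftU L M u hu k i ν b : Matrix n n ℂ)‖ ≤ σU * θc ^ k / (lev L i : ℕ))
    {C : ℝ} (hC : 0 ≤ C) (hNE3 : LocalRate (bgReadings L M (regClass L M (topAdT L M hF (liftU L M u hu)))) C ((L : ℝ)⁻¹))
    (hYP : ∀ k i x μ r, YxT L M (fundT L M (liftU L M u hu k)) i x μ r ∈ P)
    {bS σS σS' bB σB σB' : ℝ} (hbS : 0 ≤ bS) (hσS : 0 ≤ σS) (hσS' : 0 ≤ σS') (hbB : 0 ≤ bB) (hσB : 0 ≤ σB) (hσB' : 0 ≤ σB')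
    (hSb : ∀ k μ ν x, ‖Sfield (fine (lev L k) M) (lev L k) c e (fun ν x => (topU L M u hu k ν x : Matrix n n ℂ)) μ ν x‖ ≤ bS)
    (hSc : ∀ k μ ν (y : Tor (fine (lev L (k + 1)) M)), ‖Sfield (fine (lev L (k + 1)) M) (lev L (k + 1)) c e (fun ν x => (topU L M u hu (k + 1) ν x : Matrix n n ℂ)) μ ν y
      - Sfield (fine (lev L k) M) (lev L k) c e (fun ν x => (topU L M u hu k ν x : Matrix n n ℂ)) μ ν (par (lev L k) L M y)‖ ≤ σS / (lev L k : ℕ))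
    (hSl : ∀ k μ ν lam (x : Tor (fine (lev L k) M)), ‖Sfield (fine (lev L k) M) (lev L k) c e (fun ν x => (topU L M u hu k ν x : Matrix n n ℂ)) μ ν (x - unitVec _ lam)
      - Sfield (fine (lev L k) M) (lev L k) c e (fun ν x => (topU L M u hu k ν x : Matrix n n ℂ)) μ ν x‖ ≤ σS' / (lev L k : ℕ))
    (hBb : ∀ k μ ν x, ‖Bfield (fine (lev L k) M) (lev L k) c e (fun ν x => (topU L M u hu k ν x : Matrix n n ℂ)) μ ν x‖ ≤ bB)
    (hBc : ∀ k μ ν (y : Tor (fine (lev L (k + 1)) M)), ‖Bfield (fine (lev L (k + 1)) M) (lev L (k + 1)) c e (fun ν x => (topU L M u hu (k + 1) ν x : Matrix n n ℂ)) μ ν y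
      - Bfield (fine (lev L k) M) (lev L k) c e (fun ν x => (topU L M u hu k ν x : Matrix n n ℂ)) μ ν (par (lev L k) L M y)‖ ≤ σB / (lev L k : ℕ))
    (hBl : ∀ k μ ν lam (x : Tor (fine (lev L k) M)), ‖Bfield (fine (lev L k) M) (lev L k) c e (fun ν x => (topU L M u hu k ν x : Matrix n n ℂ)) μ ν (x - unitVec _ lam)
      - Bfield (fine (lev L k) M) (lev L k) c e (fun ν x => (topU L M u hu k ν x : Matrix n n ℂ)) μ ν x‖ ≤ σB' / (lev L k : ℕ))
    (hsmall : kappaB ι d a (2 * αU) (2 * βU) C (kappaQ d a (a : ℂ) (Fintype.card ι * (Real.exp ((((d + 1) * L : ℕ) : ℝ) * (2 * αU)) - 1)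
      + (1 + Fintype.card ι * (Real.exp ((((d + 1) * L : ℕ) : ℝ) * (2 * αU)) - 1)) * cR d L ι * GamU d (2 * pU) * Real.exp (EU ι d L αU (2 * pU)))) (kappaDP d a bS bB) < 1) :
    TowerLimitRate (fun k => Qlev L M k ⊗ₖ (1 : Matrix ι ι ℂ)) ((L : ℝ) ^ d)
      (fun k => (calDalev L M a ha k ⊗ₖ (1 : Matrix ι ι ℂ)
        + tierBPert L M (topAdT L M hF (liftU L M u hu)) (avgPertFull L M a (fun k => TBal L M (adT L M hF (liftU L M u hu k)) k)
            (fun k => Erem L M (adT L M hF (liftU L M u hu k)) (remCoeffOf L M (fundT L M (liftU L M u hu k)) c e (adT L M hF (liftU L M u hu k))) k))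
            (fun k => deltaPrime (fine (lev L k) M) (lev L k) c e (fun ν x => (topU L M u hu k ν x : Matrix n n ℂ))) k)⁻¹)
      (Cpert (kappaB ι d a (2 * αU) (2 * βU) C (kappaQ d a (a : ℂ) (Fintype.card ι * (Real.exp ((((d + 1) * L : ℕ) : ℝ) * (2 * αU)) - 1)
          + (1 + Fintype.card ι * (Real.exp ((((d + 1) * L : ℕ) : ℝ) * (2 * αU)) - 1)) * cR d L ι * GamU d (2 * pU) * Real.exp (EU ι d L αU (2 * pU)))) (kappaDP d a bS bB)) (2 * d * Cst d a) (CJ d a)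
        (C2B ι d L a (2 * αU) (2 * βU) C
          (a * C2gram (Cst d a) 1 (Fintype.card ι * (Real.exp ((((d + 1) * L : ℕ) : ℝ) * (2 * αU)) - 1)
              + (1 + Fintype.card ι * (Real.exp ((((d + 1) * L : ℕ) : ℝ) * (2 * αU)) - 1)) * cR d L ι * GamU d (2 * pU) * Real.exp (EU ι d L αU (2 * pU))) (2 * d * Cst d a) (CJ d a) (Cst d a)
            (Cst d a * Fintype.card ι * (thetaZero d L (2 * αU) (2 * σU) + (Real.exp ((((d + 1) * L : ℕ) : ℝ) * (2 * αU)) - 1)) + CrU ι d L a αU σU (2 * pU)))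
          (max (CDP d a bS (bS * (4 * αU) + (σS + σS') + bS * (4 * αU)) bB (bB * (4 * αU) + (σB + σB') + bB * (4 * αU))) 0)) 0 1) ρ := by
  have h0 : (0 : ℝ) ≤ (L : ℝ)⁻¹ := inv_nonneg.mpr (Nat.cast_nonneg L)
  have hρ0 : 0 ≤ ρ := hθ0.trans hθρ
  have hLρ : (L : ℝ)⁻¹ ≤ ρ := by
    have hL1 : (1 : ℝ) ≤ L := by exact_mod_cast (by omega : 1 ≤ L)
    have hLpos : (0 : ℝ) < L := by linarith
    have : (L : ℝ)⁻¹ ≤ 3 / (2 * (L : ℝ)) := by rw [div_eq_mul_inv, mul_inv, ← mul_assoc]; nlinarith [inv_pos.mpr hLpos]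
    exact this.trans hρ
  -- the size letter of the finest fields in `Δ′`'s convention
  have hV1 : ∀ k μ x, ‖((topU L M u hu k μ x : Matrix.unitaryGroup n ℂ) : Matrix n n ℂ) - 1‖ ≤ αU / (lev L k : ℕ) := fun k μ x => hUa k k μ (x, μ)
  -- `Δ′`'s laws from the letters
  have hΔ := perturbationLaws_deltaPrime' L M a ha c e (fun k ν x => (topU L M u hu k ν x : Matrix n n ℂ))
    (fun μ ν jj => boundedBackgroundM_zS_of_small L M hF (topU L M u hu) hαU hbS hσS hσS' hV1 hSb hSc hSl μ ν jj)
    (fun μ ν jj => boundedBackgroundM_zF_of_small L M hF (topU L M u hu) hαU hbB hσB hσB' hV1 hBb hBc hBl μ ν jj)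
    (fun μ ν jj => boundedBackgroundM_zB_of_small L M hF (topU L M u hu) hαU hbB hσB hσB' hV1 hBb hBc hBl μ ν jj)
  have hP₄ : PerturbationLaws (fun k => calDalev L M a ha k ⊗ₖ (1 : Matrix ι ι ℂ)) (fun k => deltaPrime (fine (lev L k) M) (lev L k) c e (fun ν x => (topU L M u hu k ν x : Matrix n n ℂ)))
      (fun k => JpcT L M k ⊗ₖ (1 : Matrix ι ι ℂ)) (kappaDP d a bS bB)
      (fun k => max (CDP d a bS (bS * (4 * αU) + (σS + σS') + bS * (4 * αU)) bB (bB * (4 * αU) + (σB + σB') + bB * (4 * αU))) 0 * ρ ^ k) := by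
    refine perturbationLaws_mono hΔ le_rfl fun k => ?_
    calc CDP d a bS (bS * (4 * αU) + (σS + σS') + bS * (4 * αU)) bB (bB * (4 * αU) + (σB + σB') + bB * (4 * αU)) * ((L : ℝ)⁻¹) ^ k
        ≤ max (CDP d a bS (bS * (4 * αU) + (σS + σS') + bS * (4 * αU)) bB (bB * (4 * αU) + (σB + σB') + bB * (4 * αU))) 0 * ((L : ℝ)⁻¹) ^ k :=
          mul_le_mul_of_nonneg_right (le_max_left _ _) (pow_nonneg h0 k)
      _ ≤ _ := mul_le_mul_of_nonneg_left (pow_le_pow_left₀ h0 hLρ k) (le_max_right _ _)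
  exact composed_full_averaging_rate_of_coherentTowers L M hF a ha hL hd hu hcoh hjunk hαU hβU hσU hθ0 hθ1 hθρ hρ hρ1 hpU hth hpUs htop hUa hUb hUc hC hNE3 hYP hP₄ hsmall

end Summit.QuantumFields.BalabanUV.T4Continuum.NE2.ComposedRemainderCoherentTowerDeltaPrime

end
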